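import Literature.Probability.RandomPlanarGeometry.SkorokhodStage
import Literature.Probability.Process.DoobMaximalIneq
import HarnessLib

/-!
# Compensated sums on a finite filtered probability space and Kolmogorov's inequality

Topic `Probability/RandomPlanarGeometry`, sub-namespace `SkorokhodEmbedding`. Support file for the
driving-function convergence engine of Lawler–Schramm–Werner (2004), §3.3 (proof of Thm. 3.7,
reused for Thm. 4.4): the two applications of "Doob's maximal inequality for `L²` martingales"
on p. 955 of the journal version (arXiv pp. 14–15) are instances of the following elementary
facts, all PROVED here (no named fact is introduced):

* `integral_sub_sq_of_martingale_nat`, `integral_sq_eq_of_martingale_nat`: orthogonality of the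
  increments of a square-integrable discrete-time martingale,
  `E[M_N²] = E[M_0²] + ∑_{k<N} E[(M_{k+1} - M_k)²]`;
* `measure_max_ge_le_of_martingale_nat`: **Kolmogorov's inequality**
  `λ² · μ{max_{k ≤ N} |M_k| ≥ λ} ≤ E[M_0²] + ∑_{k<N} E[(M_{k+1} - M_k)²]`
  (from the tree's discrete Doob inequality `doob_sq_maximal_ineq_grid`);
* for martingale data `D` on a finite probability space (`MartingaleData`, the partitions `H k`
  refining): the natural filtration `D.filtration`, atomwise conditional means `D.condMean`,
  the **compensated process** `D.comp ξ` of an adapted sequence `ξ` (subtract the conditional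
  means of the increments), the fact that it is a martingale (`martingale_comp`), the bound
  `E[(Δ comp)²] ≤ E[(Δ ξ)²]`, and the packaged maximal bound `measureReal_max_comp_ge_le`:
  `P{max_{k≤N} |comp_k| ≥ λ} ≤ (∑_{k<N} E[(ξ_{k+1} - ξ_k)²]) / λ²` when `ξ 0 = 0`.

## References

* G. F. Lawler, O. Schramm, W. Werner, Ann. Probab. 32 (2004), §3.3 (proof of Thm. 3.7).
* R. Durrett, *Probability: Theory and Examples*, 5th ed. (2019), §4.4: Thm. 4.4.2 (Doob's
  inequality, p. 224), Example 4.4.3 (the martingale form of Kolmogorov's maximal inequality,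
  Thm. 2.5.5, p. 110, from it; p. 225), Thm. 4.4.7 (orthogonality of martingale increments) and
  Thm. 4.4.8 (conditional variance formula), p. 226.
-/

noncomputable section

open MeasureTheory ProbabilityTheory Filter Set
open scoped NNReal ENNReal Topology

namespace Literature.Probability.RandomPlanarGeometry.SkorokhodEmbedding

/-! ### Discrete-time square-integrable martingales -/

section NatMartingale

variable {Ω : Type*} {m : MeasurableSpace Ω} {μ : Measure Ω} [IsFiniteMeasure μ]
  {𝓕 : Filtration ℕ m} {M : ℕ → Ω → ℝ}

/-- **Orthogonality of martingale increments** (discrete time): for a square-integrable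
martingale and `a ≤ b`, `E[(M_b - M_a)²] = E[M_b²] - E[M_a²]`. Durrett (2019), Thms. 4.4.7–4.4.8
(orthogonality of martingale increments, conditional variance formula), p. 226.
[cite: Durrett2019, Thm. 4.4.8] -/
theorem integral_sub_sq_of_martingale_nat (hM : Martingale M 𝓕 μ) (hL2 : ∀ n, MemLp (M n) 2 μ)
    {a b : ℕ} (hab : a ≤ b) :
    ∫ ω, (M b ω - M a ω) ^ 2 ∂μ = ∫ ω, M b ω ^ 2 ∂μ - ∫ ω, M a ω ^ 2 ∂μ := by
  have hDint : Integrable (M b - M a) μ := ((hL2 b).sub (hL2 a)).integrable one_le_two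
  have hcond : μ[M b - M a | 𝓕 a] =ᵐ[μ] 0 := by
    have h1 := condExp_sub ((hL2 b).integrable one_le_two) ((hL2 a).integrable one_le_two) (𝓕 a)
      (μ := μ)
    have h2 := hM.condExp_ae_eq hab
    have h3 : μ[M a | 𝓕 a] = M a :=
      condExp_of_stronglyMeasurable (𝓕.le a) (hM.1 a) ((hL2 a).integrable one_le_two)
    filter_upwards [h1, h2] with ω hω hω'
    rw [hω, Pi.sub_apply, hω', h3, Pi.zero_apply, sub_self]
  have horth : ∫ ω, M a ω * (M b - M a) ω ∂μ = 0 := by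
    have h1 : ∫ ω, (M a * (M b - M a)) ω ∂μ = ∫ ω, (μ[M a * (M b - M a) | 𝓕 a]) ω ∂μ :=
      (integral_condExp (𝓕.le a)).symm
    have h2 := condExp_mul_of_stronglyMeasurable_left (hM.1 a)
      ((hL2 a).integrable_mul ((hL2 b).sub (hL2 a))) hDint (μ := μ) (m := 𝓕 a)
    have h3 : ∫ ω, (μ[M a * (M b - M a) | 𝓕 a]) ω ∂μ = ∫ ω, (0 : ℝ) ∂μ := by
      refine integral_congr_ae ?_
      filter_upwards [h2, hcond] with ω hω hω'
      rw [hω, Pi.mul_apply, hω', Pi.zero_apply, mul_zero]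
    have : ∫ ω, M a ω * (M b - M a) ω ∂μ = ∫ ω, (M a * (M b - M a)) ω ∂μ := rfl
    rw [this, h1, h3, integral_zero]
  have hexp : ∀ ω, M b ω ^ 2 = (M a ω ^ 2 + 2 * (M a ω * (M b - M a) ω)) + (M b ω - M a ω) ^ 2 := by
    intro ω; simp only [Pi.sub_apply]; ring
  have hI0 : Integrable (fun ω ↦ 2 * (M a ω * (M b - M a) ω)) μ :=
    ((hL2 a).integrable_mul ((hL2 b).sub (hL2 a))).const_mul 2
  have hI1 : Integrable (fun ω ↦ M a ω ^ 2 + 2 * (M a ω * (M b - M a) ω)) μ :=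
    (hL2 a).integrable_sq.add hI0
  have hI2 : Integrable (fun ω ↦ (M b ω - M a ω) ^ 2) μ := by
    have := ((hL2 b).sub (hL2 a)).integrable_sq
    exact this
  conv_rhs => rw [integral_congr_ae (ae_of_all _ hexp)]
  rw [integral_add hI1 hI2, integral_add (hL2 a).integrable_sq hI0, MeasureTheory.integral_const_mul,
    horth]
  ring

/-- **Second moments of a discrete square-integrable martingale**:
`E[M_N²] = E[M_0²] + ∑_{k<N} E[(M_{k+1} - M_k)²]`. [cite: Durrett2019, Thm. 4.4.7] -/
theorem integral_sq_eq_of_martingale_nat (hM : Martingale M 𝓕 μ) (hL2 : ∀ n, MemLp (M n) 2 μ)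
    (N : ℕ) :
    ∫ ω, M N ω ^ 2 ∂μ = ∫ ω, M 0 ω ^ 2 ∂μ + ∑ k ∈ Finset.range N, ∫ ω, (M (k + 1) ω - M k ω) ^ 2 ∂μ := by
  rw [Finset.sum_congr rfl fun k _ ↦ integral_sub_sq_of_martingale_nat hM hL2 (Nat.le_succ k),
    Finset.sum_range_sub (fun k ↦ ∫ ω, M k ω ^ 2 ∂μ)]
  ring

/-- **Kolmogorov's inequality** for a discrete square-integrable martingale:
`λ² · μ{∃ k ≤ N, λ ≤ |M_k|} ≤ E[M_0²] + ∑_{k<N} E[(M_{k+1} - M_k)²]` (Doob's inequality,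
Durrett (2019), Thm. 4.4.2, p. 224 — the actual ingredient, via the tree's
`doob_sq_maximal_ineq_grid` — for the submartingale `M²`, and orthogonality of increments; the
name is that of Durrett's Thm. 2.5.5, p. 110, of which this is the martingale form, Example 4.4.3,
p. 225). Lawler–Schramm–Werner (2004), §3.3 ("Doob's maximal inequality for `L²` martingales").
[cite: Durrett2019, Thm. 4.4.2] -/
theorem measure_max_ge_le_of_martingale_nat (hM : Martingale M 𝓕 μ) (hL2 : ∀ n, MemLp (M n) 2 μ)
    {lam : ℝ} (hlam : 0 < lam) (N : ℕ) :
    ENNReal.ofReal (lam ^ 2) * μ {ω | ∃ k ≤ N, lam ≤ |M k ω|} ≤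
      ENNReal.ofReal (∫ ω, M 0 ω ^ 2 ∂μ + ∑ k ∈ Finset.range N, ∫ ω, (M (k + 1) ω - M k ω) ^ 2 ∂μ) := by
  rw [← integral_sq_eq_of_martingale_nat hM hL2 N]
  exact Literature.Probability.Process.doob_sq_maximal_ineq_grid hM hL2 (τ := id) monotone_id hlam N

/-- Real-valued form of Kolmogorov's inequality:
`μ.real{∃ k ≤ N, λ ≤ |M_k|} ≤ (E[M_0²] + ∑_{k<N} E[(M_{k+1} - M_k)²]) / λ²`.
[cite: Durrett2019, Thm. 4.4.2] -/
theorem measureReal_max_ge_le_of_martingale_nat (hM : Martingale M 𝓕 μ) (hL2 : ∀ n, MemLp (M n) 2 μ)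
    {lam : ℝ} (hlam : 0 < lam) (N : ℕ) :
    μ.real {ω | ∃ k ≤ N, lam ≤ |M k ω|} ≤
      (∫ ω, M 0 ω ^ 2 ∂μ + ∑ k ∈ Finset.range N, ∫ ω, (M (k + 1) ω - M k ω) ^ 2 ∂μ) / lam ^ 2 := by
  have h := measure_max_ge_le_of_martingale_nat hM hL2 hlam N
  have hS : 0 ≤ ∫ ω, M 0 ω ^ 2 ∂μ + ∑ k ∈ Finset.range N, ∫ ω, (M (k + 1) ω - M k ω) ^ 2 ∂μ :=
    add_nonneg (integral_nonneg fun _ ↦ sq_nonneg _)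
      (Finset.sum_nonneg fun _ _ ↦ integral_nonneg fun _ ↦ sq_nonneg _)
  have hl2 : 0 < lam ^ 2 := pow_pos hlam 2
  have h' := ENNReal.toReal_mono ENNReal.ofReal_ne_top h
  rw [ENNReal.toReal_mul, ENNReal.toReal_ofReal hl2.le, ENNReal.toReal_ofReal hS,
    ← measureReal_def] at h'
  rw [le_div_iff₀ hl2, mul_comm]
  exact h'

end NatMartingale

/-! ### Finite filtered probability spaces: integrals as sums -/

section FiniteSpace

variable {Ω : Type*} [Fintype Ω] [MeasurableSpace Ω] [MeasurableSingletonClass Ω]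
  {P : Measure Ω} [IsFiniteMeasure P]

/-- On a finite type with measurable singletons every function is integrable for a finite
measure. [folklore] -/
theorem integrable_of_fintype (f : Ω → ℝ) : Integrable f P :=
  Integrable.of_finite

/-- Integrals on a finite probability space are finite sums. [folklore] -/
theorem integral_eq_sum_fintype (f : Ω → ℝ) : ∫ ω, f ω ∂P = ∑ ω, P.real {ω} * f ω := by
  rw [integral_fintype (integrable_of_fintype f)]
  rfl

/-- Set integrals on a finite probability space are finite sums over the set. [folklore] -/
theorem setIntegral_eq_sum_finset (f : Ω → ℝ) (s : Finset Ω) :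
    ∫ ω in (s : Set Ω), f ω ∂P = ∑ ω ∈ s, P.real {ω} * f ω := by
  rw [integral_eq_sum_fintype]
  classical
  rw [← Finset.sum_subset (Finset.subset_univ s)]
  · refine Finset.sum_congr rfl fun ω hω ↦ ?_
    rw [measureReal_def, Measure.restrict_apply (measurableSet_singleton ω),
      Set.inter_eq_left.2 (Set.singleton_subset_iff.2 (Finset.mem_coe.2 hω)), ← measureReal_def]
  · intro ω _ hω
    rw [measureReal_def, Measure.restrict_apply (measurableSet_singleton ω),
      Set.singleton_inter_eq_empty.2 (fun h ↦ hω (Finset.mem_coe.1 h)), measure_empty,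
      ENNReal.toReal_zero, zero_mul]

end FiniteSpace

/-! ### The natural filtration of martingale data and compensated sums -/

namespace MartingaleData

variable {Ω Λ : Type*} [Fintype Ω] [MeasurableSpace Ω] [DecidableEq Λ] (D : MartingaleData Ω Λ)

/-- The σ-algebra generated by the history `H k` (all level sets). [folklore] -/
@[reducible] def filt (k : ℕ) : MeasurableSpace Ω := (⊤ : MeasurableSpace Λ).comap (D.H k)

omit [Fintype Ω] [DecidableEq Λ] in
/-- A set is `σ(H k)`-measurable iff it is a union of atoms of level `k`, i.e. saturated for
`H k`. [folklore] -/
theorem measurableSet_filt_iff {k : ℕ} {A : Set Ω} :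
    MeasurableSet[D.filt k] A ↔ ∀ ω ω', D.H k ω = D.H k ω' → ω ∈ A → ω' ∈ A := by
  constructor
  · rintro ⟨S, -, rfl⟩ ω ω' h hω
    simp only [mem_preimage] at hω ⊢
    rwa [← h]
  · intro h
    refine ⟨D.H k '' A, MeasurableSpace.measurableSet_top, ?_⟩
    ext ω'
    simp only [mem_preimage, mem_image]
    exact ⟨fun ⟨ω, hω, hωω'⟩ ↦ h ω ω' hωω' hω, fun hω' ↦ ⟨ω', hω', rfl⟩⟩

omit [Fintype Ω] [DecidableEq Λ] in
/-- A function constant on the atoms of level `k` is `σ(H k)`-measurable. [folklore] -/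
theorem measurable_filt_of_factor {β : Type*} [MeasurableSpace β] {k : ℕ} {f : Ω → β}
    (hf : ∀ ω ω', D.H k ω = D.H k ω' → f ω = f ω') : Measurable[D.filt k] f := by
  intro s _
  rw [D.measurableSet_filt_iff]
  intro ω ω' h hω
  simp only [mem_preimage] at hω ⊢
  rwa [← hf ω ω' h]

variable {D}

/-- The natural σ-algebras increase (the partitions refine). [folklore] -/
theorem filt_mono (hD : D.IsValid) : Monotone D.filt := by
  refine monotone_nat_of_le_succ fun k A hA ↦ ?_
  rw [D.measurableSet_filt_iff] at hA ⊢
  exact fun ω ω' h hω ↦ hA ω ω' (hD.refine (Nat.le_succ k) h) hω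

omit [DecidableEq Λ] in
/-- On a finite space with measurable singletons every σ-algebra of subsets is dominated by the
ambient one. [folklore] -/
theorem filt_le [MeasurableSingletonClass Ω] (k : ℕ) : D.filt k ≤ ‹MeasurableSpace Ω› :=
  fun A _ ↦ (Set.toFinite A).measurableSet

/-- **The natural filtration** `σ(H 0) ≤ σ(H 1) ≤ ⋯` of martingale data.
[cite: LawlerSchrammWerner2004, Lemma 3.8] -/
def filtration [MeasurableSingletonClass Ω] (hD : D.IsValid) : Filtration ℕ ‹MeasurableSpace Ω› :=
  ⟨D.filt, filt_mono hD, filt_le⟩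

variable (D)

/-- **Atomwise conditional mean** of a function given `H k = l`:
`E[f | H k = l] = (∑_{atom} P{ω} f ω) / P[H k = l]` (and `0` on null atoms). [folklore] -/
def condMean (k : ℕ) (f : Ω → ℝ) (l : Λ) : ℝ := (∑ ω ∈ D.atom k l, D.P.real {ω} * f ω) / D.pH k l

/-- The defining identity of the conditional mean on an atom:
`∑_{atom} P{ω} f ω = P[H k = l] · E[f | H k = l]` (both sides vanish on a null atom).
[folklore] -/
theorem sum_atom_mul_eq (k : ℕ) (f : Ω → ℝ) (l : Λ) :
    ∑ ω ∈ D.atom k l, D.P.real {ω} * f ω = D.pH k l * D.condMean k f l := by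
  by_cases hl : D.pH k l = 0
  · -- a null atom carries no mass at all
    have h0 : ∀ ω ∈ D.atom k l, D.P.real {ω} = 0 := by
      intro ω hω
      have hle : D.P.real {ω} ≤ D.pH k l :=
        Finset.single_le_sum (f := fun ω ↦ D.P.real {ω}) (fun _ _ ↦ measureReal_nonneg) hω
      rw [hl] at hle
      exact le_antisymm hle measureReal_nonneg
    rw [hl, zero_mul]
    exact Finset.sum_eq_zero fun ω hω ↦ by rw [h0 ω hω, zero_mul]
  · rw [condMean, mul_div_cancel₀ _ hl]

/-- The conditional mean of a sum. [folklore] -/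
theorem condMean_add (k : ℕ) (f g : Ω → ℝ) (l : Λ) :
    D.condMean k (f + g) l = D.condMean k f l + D.condMean k g l := by
  simp only [condMean, Pi.add_apply, mul_add, Finset.sum_add_distrib, add_div]

/-- The conditional mean of a scalar multiple. [folklore] -/
theorem condMean_const_mul (k : ℕ) (c : ℝ) (f : Ω → ℝ) (l : Λ) :
    D.condMean k (fun ω ↦ c * f ω) l = c * D.condMean k f l := by
  simp only [condMean]
  rw [mul_div_assoc', Finset.mul_sum]
  congr 1
  exact Finset.sum_congr rfl fun ω _ ↦ by ring

/-- A bounded function has a bounded conditional mean (on non-null atoms; `0` else).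
[folklore] -/
theorem abs_condMean_le (k : ℕ) {f : Ω → ℝ} {l : Λ} {b : ℝ} (hb : 0 ≤ b)
    (hf : ∀ ω ∈ D.atom k l, |f ω| ≤ b) : |D.condMean k f l| ≤ b := by
  by_cases hl : D.pH k l = 0
  · rw [condMean, hl, div_zero, abs_zero]; exact hb
  have hpos : 0 < D.pH k l := lt_of_le_of_ne (MartingaleData.pH_nonneg k l) (Ne.symm hl)
  rw [condMean, abs_div, abs_of_pos hpos, div_le_iff₀ hpos]
  calc |∑ ω ∈ D.atom k l, D.P.real {ω} * f ω| ≤ ∑ ω ∈ D.atom k l, |D.P.real {ω} * f ω| :=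
        Finset.abs_sum_le_sum_abs _ _
    _ ≤ ∑ ω ∈ D.atom k l, D.P.real {ω} * b := Finset.sum_le_sum fun ω hω ↦ by
        rw [abs_mul, abs_of_nonneg measureReal_nonneg]
        exact mul_le_mul_of_nonneg_left (hf ω hω) measureReal_nonneg
    _ = b * D.pH k l := by rw [← Finset.sum_mul, MartingaleData.pH, mul_comm]

/-- **The conditional variance is at most the conditional second moment**:
`∑_{atom} P{ω} (f ω - E[f|atom])² ≤ ∑_{atom} P{ω} (f ω)²`. [folklore] -/
theorem sum_atom_mul_sub_condMean_sq_le (k : ℕ) (f : Ω → ℝ) (l : Λ) :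
    ∑ ω ∈ D.atom k l, D.P.real {ω} * (f ω - D.condMean k f l) ^ 2 ≤
      ∑ ω ∈ D.atom k l, D.P.real {ω} * f ω ^ 2 := by
  set c := D.condMean k f l with hc
  have hexp : ∀ ω, D.P.real {ω} * (f ω - c) ^ 2 =
      D.P.real {ω} * f ω ^ 2 - 2 * c * (D.P.real {ω} * f ω) + c ^ 2 * D.P.real {ω} := by
    intro ω; ring
  rw [Finset.sum_congr rfl fun ω _ ↦ hexp ω, Finset.sum_add_distrib, Finset.sum_sub_distrib,
    ← Finset.mul_sum, ← Finset.mul_sum, D.sum_atom_mul_eq k f l, ← hc, ← MartingaleData.pH]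
  nlinarith [MartingaleData.pH_nonneg (D := D) k l, sq_nonneg c]

/-! ### Adapted sequences and their compensated sums -/

/-- A sequence `ξ k : Ω → ℝ` is **adapted** to the histories when `ξ k` is constant on the atoms
of `H k`. [folklore] -/
def IsAdaptedSeq (ξ : ℕ → Ω → ℝ) : Prop := ∀ k ω ω', D.H k ω = D.H k ω' → ξ k ω = ξ k ω'

/-- **The drift** (predictable compensator increment) of an adapted sequence:
`E[ξ_{k+1} - ξ_k | H k]`. [folklore] -/
def drift (ξ : ℕ → Ω → ℝ) (k : ℕ) (ω : Ω) : ℝ := D.condMean k (fun ω' ↦ ξ (k + 1) ω' - ξ k ω') (D.H k ω)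

/-- **The compensated process** `ξ_n - ∑_{j<n} E[ξ_{j+1} - ξ_j | H j]`.
Lawler–Schramm–Werner (2004), §3.3 (`Z'_n := Z_n - ∑_{j=1}^n E[Z_j - Z_{j-1} | 𝓕_{j-1}]`).
[cite: LawlerSchrammWerner2004, Theorem 3.7] -/
def comp (ξ : ℕ → Ω → ℝ) (n : ℕ) (ω : Ω) : ℝ := ξ n ω - ∑ j ∈ Finset.range n, D.drift ξ j ω

variable {D}

/-- The drift at level `k` is constant on the atoms of level `k`. [folklore] -/
theorem drift_factor (ξ : ℕ → Ω → ℝ) (k : ℕ) {ω ω' : Ω} (h : D.H k ω = D.H k ω') :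
    D.drift ξ k ω = D.drift ξ k ω' := by
  simp only [drift, h]

/-- The compensated process is adapted. [folklore] -/
theorem comp_factor (hD : D.IsValid) {ξ : ℕ → Ω → ℝ} (hξ : D.IsAdaptedSeq ξ) (n : ℕ) {ω ω' : Ω}
    (h : D.H n ω = D.H n ω') : D.comp ξ n ω = D.comp ξ n ω' := by
  simp only [comp]
  rw [hξ n ω ω' h, Finset.sum_congr rfl fun j hj ↦ drift_factor ξ j
    (hD.refine (Finset.mem_range.1 hj).le h)]

/-- The increment of the compensated process. [folklore] -/
theorem comp_succ_sub (ξ : ℕ → Ω → ℝ) (n : ℕ) (ω : Ω) :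
    D.comp ξ (n + 1) ω - D.comp ξ n ω = (ξ (n + 1) ω - ξ n ω) - D.drift ξ n ω := by
  simp only [comp, Finset.sum_range_succ]
  ring

/-- At time `0` the compensated process is `ξ 0`. [folklore] -/
theorem comp_zero (ξ : ℕ → Ω → ℝ) (ω : Ω) : D.comp ξ 0 ω = ξ 0 ω := by
  simp [comp]

/-- **The compensated increments have zero mass on every atom of the current level.**
[folklore] -/
theorem sum_atom_mul_comp_succ_sub (ξ : ℕ → Ω → ℝ) (n : ℕ) (l : Λ) :
    ∑ ω ∈ D.atom n l, D.P.real {ω} * (D.comp ξ (n + 1) ω - D.comp ξ n ω) = 0 := by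
  have h1 : ∀ ω ∈ D.atom n l, D.P.real {ω} * (D.comp ξ (n + 1) ω - D.comp ξ n ω) =
      D.P.real {ω} * (ξ (n + 1) ω - ξ n ω) -
        D.P.real {ω} * D.condMean n (fun ω' ↦ ξ (n + 1) ω' - ξ n ω') l := by
    intro ω hω
    rw [MartingaleData.mem_atom] at hω
    rw [comp_succ_sub, drift, hω]
    ring
  rw [Finset.sum_congr rfl h1, Finset.sum_sub_distrib,
    D.sum_atom_mul_eq n (fun ω ↦ ξ (n + 1) ω - ξ n ω) l, ← Finset.sum_mul, ← MartingaleData.pH,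
    sub_self]

section Measure

variable [MeasurableSingletonClass Ω]

/-- **The compensated process is a martingale** for the natural filtration.
Lawler–Schramm–Werner (2004), §3.3 ("Since this is an `𝓕_n`-martingale …").
[cite: LawlerSchrammWerner2004, Theorem 3.7] -/
theorem martingale_comp (hD : D.IsValid) {ξ : ℕ → Ω → ℝ} (hξ : D.IsAdaptedSeq ξ) :
    Martingale (D.comp ξ) (filtration hD) D.P := by
  haveI := hD.prob
  refine martingale_of_setIntegral_eq_succ (fun n ↦ ?_) (fun n ↦ integrable_of_fintype _) ?_
  · exact (D.measurable_filt_of_factor (fun ω ω' h ↦ comp_factor hD hξ n h)).stronglyMeasurable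
  · intro n A hA
    change MeasurableSet[D.filt n] A at hA
    classical
    -- `A` is a union of atoms of level `n`; on each atom the compensated increment has zero mass
    have hAfin : A = ↑(Finset.univ.filter (fun ω ↦ ω ∈ A)) := by
      ext ω; simp
    rw [hAfin, setIntegral_eq_sum_finset, setIntegral_eq_sum_finset]
    rw [← sub_eq_zero, ← Finset.sum_sub_distrib]
    simp_rw [← mul_sub]
    -- regroup by the value of `H n`
    rw [← Finset.sum_fiberwise_of_maps_to (g := D.H n) (t := Finset.univ.image (D.H n))
      (fun ω _ ↦ Finset.mem_image_of_mem _ (Finset.mem_univ ω))]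
    refine Finset.sum_eq_zero fun l _ ↦ ?_
    rw [D.measurableSet_filt_iff] at hA
    -- the fibre of `A` over `l` is either empty or the whole atom
    by_cases hne : ∃ ω ∈ A, D.H n ω = l
    · obtain ⟨ω₀, hω₀A, hω₀⟩ := hne
      have hfib : (Finset.univ.filter (fun ω ↦ ω ∈ A)).filter (fun ω ↦ D.H n ω = l) = D.atom n l := by
        ext ω
        simp only [Finset.mem_filter, Finset.mem_univ, true_and, MartingaleData.mem_atom]
        exact ⟨fun h ↦ h.2, fun h ↦ ⟨hA ω₀ ω (hω₀.trans h.symm) hω₀A, h⟩⟩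
      rw [hfib]
      have := sum_atom_mul_comp_succ_sub (D := D) ξ n l
      rw [← neg_eq_zero, ← this, ← Finset.sum_neg_distrib]
      exact Finset.sum_congr rfl fun ω _ ↦ by ring
    · rw [Finset.sum_eq_zero]
      intro ω hω
      simp only [Finset.mem_filter, Finset.mem_univ, true_and] at hω
      exact absurd ⟨ω, hω.1, hω.2⟩ hne

/-- The compensated process is square integrable. [folklore] -/
theorem memLp_comp (hD : D.IsValid) (ξ : ℕ → Ω → ℝ) (n : ℕ) : MemLp (D.comp ξ n) 2 D.P := by
  haveI := hD.prob
  classical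
  refine MemLp.of_bound (Measurable.of_discrete.aestronglyMeasurable)
    (∑ ω, |D.comp ξ n ω|) (ae_of_all _ fun ω ↦ ?_)
  rw [Real.norm_eq_abs]
  exact Finset.single_le_sum (f := fun ω ↦ |D.comp ξ n ω|) (fun _ _ ↦ abs_nonneg _)
    (Finset.mem_univ ω)

/-- **The compensated increments have smaller second moment than the raw increments**:
`E[(comp_{k+1} - comp_k)²] ≤ E[(ξ_{k+1} - ξ_k)²]`. [folklore] -/
theorem integral_comp_succ_sub_sq_le (hD : D.IsValid) (ξ : ℕ → Ω → ℝ) (k : ℕ) :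
    ∫ ω, (D.comp ξ (k + 1) ω - D.comp ξ k ω) ^ 2 ∂D.P ≤ ∫ ω, (ξ (k + 1) ω - ξ k ω) ^ 2 ∂D.P := by
  haveI := hD.prob
  classical
  rw [integral_eq_sum_fintype, integral_eq_sum_fintype,
    ← Finset.sum_fiberwise_of_maps_to (g := D.H k) (t := Finset.univ.image (D.H k))
      (fun ω _ ↦ Finset.mem_image_of_mem _ (Finset.mem_univ ω)),
    ← Finset.sum_fiberwise_of_maps_to (g := D.H k) (t := Finset.univ.image (D.H k))
      (s := Finset.univ) (fun ω _ ↦ Finset.mem_image_of_mem _ (Finset.mem_univ ω))]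
  refine Finset.sum_le_sum fun l _ ↦ ?_
  have hfib : Finset.univ.filter (fun ω ↦ D.H k ω = l) = D.atom k l := rfl
  rw [hfib]
  have hterm : ∀ ω ∈ D.atom k l, D.P.real {ω} * (D.comp ξ (k + 1) ω - D.comp ξ k ω) ^ 2 =
      D.P.real {ω} * ((ξ (k + 1) ω - ξ k ω) -
        D.condMean k (fun ω' ↦ ξ (k + 1) ω' - ξ k ω') l) ^ 2 := by
    intro ω hω
    rw [MartingaleData.mem_atom] at hω
    rw [comp_succ_sub, drift, hω]
  rw [Finset.sum_congr rfl hterm]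
  exact D.sum_atom_mul_sub_condMean_sq_le k (fun ω ↦ ξ (k + 1) ω - ξ k ω) l

/-- **Kolmogorov's inequality for compensated sums on a finite filtered space**: for an adapted
sequence with `ξ 0 = 0`,
`P{max_{k ≤ N} |ξ_k - ∑_{j<k} E[Δξ_j | H j]| ≥ λ} ≤ (∑_{k<N} E[(ξ_{k+1} - ξ_k)²]) / λ²`.
Lawler–Schramm–Werner (2004), §3.3 (the estimate `P[max_{n≤N} |Y_n - 2 t_{m_n}| > δ^{1/2}]
= O(N δ³)`). [cite: LawlerSchrammWerner2004, Theorem 3.7] -/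
theorem measureReal_max_comp_ge_le (hD : D.IsValid) {ξ : ℕ → Ω → ℝ} (hξ : D.IsAdaptedSeq ξ)
    (h0 : ∀ ω, ξ 0 ω = 0) {lam : ℝ} (hlam : 0 < lam) (N : ℕ) :
    D.P.real {ω | ∃ k ≤ N, lam ≤ |D.comp ξ k ω|} ≤
      (∑ k ∈ Finset.range N, ∫ ω, (ξ (k + 1) ω - ξ k ω) ^ 2 ∂D.P) / lam ^ 2 := by
  haveI := hD.prob
  have h := measureReal_max_ge_le_of_martingale_nat (martingale_comp hD hξ) (memLp_comp hD ξ) hlam N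
  have hz : ∫ ω, D.comp ξ 0 ω ^ 2 ∂D.P = 0 := by
    simp_rw [comp_zero, h0]; simp
  rw [hz, zero_add] at h
  refine h.trans (div_le_div_of_nonneg_right (Finset.sum_le_sum fun k _ ↦
    integral_comp_succ_sub_sq_le hD ξ k) (sq_nonneg lam))

/-- **Maximal bound for an adapted sequence with small drift**: if `ξ 0 = 0`,
`|ξ_{k+1} - ξ_k| ≤ b` and `|E[ξ_{k+1} - ξ_k | H k]| ≤ d` on non-null atoms (`k < N`), then
`P{max_{k ≤ N} |ξ_k| ≥ λ + N d} ≤ N b² / λ²`. Lawler–Schramm–Werner (2004), §3.3.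
[cite: LawlerSchrammWerner2004, Theorem 3.7] -/
theorem measureReal_max_ge_le_of_drift (hD : D.IsValid) {ξ : ℕ → Ω → ℝ} (hξ : D.IsAdaptedSeq ξ)
    (h0 : ∀ ω, ξ 0 ω = 0) {N : ℕ} {b d : ℝ} (hd : 0 ≤ d)
    (hb : ∀ k < N, ∀ ω, |ξ (k + 1) ω - ξ k ω| ≤ b)
    (hdrift : ∀ k < N, ∀ ω, |D.drift ξ k ω| ≤ d) {lam : ℝ} (hlam : 0 < lam) :
    D.P.real {ω | ∃ k ≤ N, lam + N * d ≤ |ξ k ω|} ≤ N * b ^ 2 / lam ^ 2 := by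
  haveI := hD.prob
  have hsub : {ω | ∃ k ≤ N, lam + N * d ≤ |ξ k ω|} ⊆ {ω | ∃ k ≤ N, lam ≤ |D.comp ξ k ω|} := by
    rintro ω ⟨k, hk, hω⟩
    refine ⟨k, hk, ?_⟩
    have hdr : |∑ j ∈ Finset.range k, D.drift ξ j ω| ≤ N * d :=
      calc |∑ j ∈ Finset.range k, D.drift ξ j ω| ≤ ∑ j ∈ Finset.range k, |D.drift ξ j ω| :=
            Finset.abs_sum_le_sum_abs _ _
        _ ≤ ∑ j ∈ Finset.range k, d := Finset.sum_le_sum fun j hj ↦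
            hdrift j (lt_of_lt_of_le (Finset.mem_range.1 hj) hk) ω
        _ = k * d := by rw [Finset.sum_const, Finset.card_range, nsmul_eq_mul]
        _ ≤ N * d := mul_le_mul_of_nonneg_right (Nat.cast_le.2 hk) hd
    have htri : |ξ k ω| ≤ |D.comp ξ k ω| + |∑ j ∈ Finset.range k, D.drift ξ j ω| := by
      rw [show ξ k ω = D.comp ξ k ω + ∑ j ∈ Finset.range k, D.drift ξ j ω by simp [comp]]
      exact abs_add_le _ _
    linarith
  refine (measureReal_mono hsub (measure_ne_top _ _)).trans
    ((measureReal_max_comp_ge_le hD hξ h0 hlam N).trans ?_)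
  have hint : ∀ k ∈ Finset.range N, ∫ ω, (ξ (k + 1) ω - ξ k ω) ^ 2 ∂D.P ≤ b ^ 2 := by
    intro k hk
    calc ∫ ω, (ξ (k + 1) ω - ξ k ω) ^ 2 ∂D.P ≤ ∫ _, b ^ 2 ∂D.P :=
          integral_mono (integrable_of_fintype _) (integrable_const _) fun ω ↦ by
            have := hb k (Finset.mem_range.1 hk) ω
            rw [← sq_abs]
            exact pow_le_pow_left₀ (abs_nonneg _) this 2
      _ = b ^ 2 := by simp
  refine div_le_div_of_nonneg_right ?_ (sq_nonneg lam)
  calc ∑ k ∈ Finset.range N, ∫ ω, (ξ (k + 1) ω - ξ k ω) ^ 2 ∂D.P ≤ ∑ k ∈ Finset.range N, b ^ 2 :=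
        Finset.sum_le_sum hint
    _ = N * b ^ 2 := by rw [Finset.sum_const, Finset.card_range, nsmul_eq_mul]

end Measure

end MartingaleData

end Literature.Probability.RandomPlanarGeometry.SkorokhodEmbedding
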